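import Mathlib
import HarnessLib
import Summits.NavierStokesRegularity.NavierStokesRegularity.Theses.RootDecompLeanestSingularity
import Literature.Analysis.FluidPDE.TypeIRateClassicalRepresentative
import Literature.Analysis.FluidPDE.KNSSTypeIRateLiouvilleMild

/-!
# RootDecompLeanestSingularity — support S2 `FrozenZoomIsLerayProfile` (stmt-NavierStokesRegularity-32163) PROVED

Route N14 `route-NavierStokesRegularity-RootDecompLeanestSingularity` (decomp-ns lens-4 g11 SPIKE ANATOMY node,
booked by writer g4): the routine regularity stub S2 — «a FROZEN field of the bounded Oseen ancient class is, at
time `−1`, a `C²` steady Navier–Stokes flow with a `C¹` pressure at viscosity one», i.e. an `IsLerayProfile 1 0`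
pair (Leray's profile system at rate `a = 0` IS steady Navier–Stokes). Concluded against the route decl BY NAME;
no new definitions.

Proof (KNSS 2009 §4 (i)–(iii), Prop. 4.1, all by tree theorems). Replace `U` by the literally time-constant
field `V _ := U (−1)`; frozenness makes `V = U` on `(−∞,0)`, so `V` is again continuous, bounded, weakly
divergence free and Oseen-mild there (the Duhamel term only samples negative times). Then
* `V` is a bounded weak solution on `(−∞,0) × ℝ³` (tree `isBoundedWeakNSSolutionOn_of_oseen`, Lemarié-Rieusset
  2016 Thm 6.1 / KNSS §4 (i)–(ii)), restricted to the window `(−2, −1/2)` (`IsBoundedWeakNSSolutionOn.mono`);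
* `V` is jointly `C^∞` on `(−2, 0) × ℝ³` (tree `contDiffOn_of_bounded_oseenMild`, KNSS Prop. 4.1);
* hence `(V, q)` is a classical solution on the window for some pressure `q` (tree
  `exists_isClassicalNSSolutionOn_of_smooth_boundedWeak`, KNSS §4 (4.3)–(4.5) / de Rham);
* the time derivative of the constant field vanishes, so the momentum equation at `t = −1` is the profile
  system with `a = 0` for `(U (−1), q (−1))`.

Navier–Stokes regularity is NOT proved by anything here (rung 0). With S2 closed, F `NoFrozenSpike` (32164)
follows from the landed S1 `NoHollowSpike.isEnvelopedFlow_of_zoomLimit` and the tree's weak-`L³` steady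
Liouville theorem (separate file).

References: KochNadirashviliSereginSverak2009 arXiv:0709.3599 §4 (i)–(iii), Prop. 4.1; LemarieRieusset2016
Thm 6.1; Leray1934 (3.12); tree `Literature.Analysis.FluidPDE.isBoundedWeakNSSolutionOn_of_oseen`,
`Literature.Analysis.FluidPDE.contDiffOn_of_bounded_oseenMild`,
`Literature.Analysis.FluidPDE.exists_isClassicalNSSolutionOn_of_smooth_boundedWeak`.
-/
noncomputable section

-- the summit and its single sub-problem share the name (CONVENTIONS §1), as in every Theorems file
set_option linter.dupNamespace false

open MeasureTheory Set Function Filter Topology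
open scoped NNReal ENNReal RealInnerProductSpace
open Literature.Analysis Literature.Analysis.FluidPDE

namespace Summit.NavierStokesRegularity.NavierStokesRegularity.Theorems.FrozenZoomIsLerayProfile

/-- **A frozen bounded Oseen-mild ancient field is a steady classical Navier–Stokes flow** at time `−1`
(KNSS 2009 §4, Prop. 4.1; the statement of S2 with the class written out). -/
theorem exists_isLerayProfile_of_frozen
    {U : ℝ → EuclideanSpace ℝ (Fin 3) → EuclideanSpace ℝ (Fin 3)}
    (hcont : ContinuousOn (uncurry U) (Iio 0 ×ˢ univ))
    (hbdd : ∃ C : ℝ, ∀ t < 0, ∀ x, ‖U t x‖ ≤ C)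
    (hdiv : ∀ t < 0, IsWeaklyDivFree (U t))
    (hmild : ∀ s t : ℝ, s < t → t < 0 → ∀ x,
      U t x = UnboundedOperators.heatExtension (U s) (t - s) x - oseenDuhamel 1 s U U t x)
    (hfro : ∀ s t : ℝ, s < 0 → t < 0 → U s = U t) :
    ∃ P : EuclideanSpace ℝ (Fin 3) → ℝ, IsLerayProfile 1 0 (U (-1)) P := by
  obtain ⟨C, hC⟩ := hbdd
  -- the time-constant representative
  set V : ℝ → EuclideanSpace ℝ (Fin 3) → EuclideanSpace ℝ (Fin 3) := fun _ => U (-1) with hV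
  have hUV : ∀ t < 0, U t = V t := fun t ht => hfro t (-1) ht (by norm_num)
  have hU1c : Continuous (U (-1)) :=
    hcont.comp_continuous (continuous_const.prodMk continuous_id) fun x =>
      ⟨show (-1 : ℝ) < 0 by norm_num, mem_univ x⟩
  have hVcont' : Continuous (uncurry V) := by
    have e : uncurry V = U (-1) ∘ Prod.snd := by funext z; rfl
    rw [e]
    exact hU1c.comp continuous_snd
  have hVcont : ContinuousOn (uncurry V) (Iio 0 ×ˢ univ) := hVcont'.continuousOn
  have hVbdd : ∃ K : ℝ, ∀ t < 0, ∀ x, ‖V t x‖ ≤ K := ⟨C, fun t _ x => hC (-1) (by norm_num) x⟩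
  have hVdiv : ∀ t < 0, IsWeaklyDivFree (V t) := fun t _ => hdiv (-1) (by norm_num)
  have hVmild : ∀ s t : ℝ, s < t → t < 0 → ∀ x,
      V t x = UnboundedOperators.heatExtension (V s) (t - s) x - oseenDuhamel 1 s V V t x := by
    intro s t hst ht x
    have hs : s < 0 := hst.trans ht
    have hD : oseenDuhamel 1 s V V t x = oseenDuhamel 1 s U U t x := by
      rw [oseenDuhamel_apply, oseenDuhamel_apply]
      refine setIntegral_congr_fun measurableSet_Ioo fun τ hτ => ?_
      simp only [hUV τ (hτ.2.trans ht)]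
    have h := hmild s t hst ht x
    rw [hUV t ht, hUV s hs, ← hD] at h
    exact h
  -- bounded weak solution on `(−∞,0)`, then on the window `(−2, −1/2)`
  have hVmild' : ∀ s t : ℝ, s < t → t < 0 → ∀ x,
      V t x = UnboundedOperators.heatExtension (V s) (1 * (t - s)) x - oseenDuhamel 1 s V V t x := by
    intro s t hst ht x
    rw [one_mul]
    exact hVmild s t hst ht x
  have hbw : IsBoundedWeakNSSolutionOn (Iio 0) isOpen_Iio 1 V :=
    isBoundedWeakNSSolutionOn_of_oseen one_pos hVcont hVbdd hVdiv hVmild'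
  have hbwW : IsBoundedWeakNSSolutionOn (Ioo (-2 : ℝ) (-1 / 2)) isOpen_Ioo 1 V :=
    hbw.mono isOpen_Ioo fun t ht => show t < 0 by linarith [ht.2]
  -- joint smoothness on `(−2, 0) × ℝ³` (KNSS Prop. 4.1)
  have hsm2 : ContDiffOn ℝ (⊤ : ℕ∞) (uncurry V) (Ioo (-2 : ℝ) 0 ×ˢ univ) :=
    contDiffOn_of_bounded_oseenMild (A := -2) (M := C) (hVcont'.continuousOn)
      (fun t ht => hVdiv t ht.2) (fun s t _ hst ht x => hVmild s t hst ht x)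
      (fun t ht x => hC (-1) (by norm_num) x)
  have hsmW : IsSmoothSpaceTimeOn (Ioo (-2 : ℝ) (-1 / 2)) V :=
    hsm2.mono (prod_mono (fun t ht => ⟨ht.1, by linarith [ht.2]⟩) subset_rfl)
  -- classical on the window for some pressure
  obtain ⟨q, hq⟩ := exists_isClassicalNSSolutionOn_of_smooth_boundedWeak hsmW hbwW
  have hm : (-1 : ℝ) ∈ Ioo (-2 : ℝ) (-1 / 2) := ⟨by norm_num, by norm_num⟩
  refine ⟨q (-1), ?_⟩
  exact
    { contDiff_velocity := (hq.contDiff_velocity hm).of_le (by norm_cast)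
      contDiff_pressure := (hq.contDiff_pressure hm).of_le (by norm_cast)
      profile_eq := fun y => by
        have hmom := hq.momentum (-1) hm y
        have h0 : timeDerivWithin (Ioo (-2 : ℝ) (-1 / 2)) V (-1) y = 0 := by
          simp [timeDerivWithin, hV]
        rw [h0, zero_add] at hmom
        simp only [hV, Pi.zero_apply, add_zero] at hmom
        rw [hmom, zero_smul, zero_smul, add_zero, add_zero]
        abel
      divFree := hq.divFree (-1) hm }

/-- **S2 `FrozenZoomIsLerayProfile` (stmt-NavierStokesRegularity-32163), concluded BY NAME.** -/
theorem frozenZoomIsLerayProfile_proof :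
    Theses.RootDecompLeanestSingularity.FrozenZoomIsLerayProfile := by
  intro U hcls hfro
  exact exists_isLerayProfile_of_frozen hcls.1 hcls.2.1 hcls.2.2.1 hcls.2.2.2 hfro

end Summit.NavierStokesRegularity.NavierStokesRegularity.Theorems.FrozenZoomIsLerayProfile
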